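import Mathlib.RingTheory.Etale.Locus
import Mathlib.RingTheory.Etale.Field
import Mathlib.RingTheory.FinitePresentation
import HarnessLib

/-!
# A finite algebra with separable fraction field extension is étale over a dense open

Topic: `Literature/AlgebraicGeometry/Resolution`. The ring-theoretic heart of de Jong 1996, 2.20:
"We remark that an alteration `S' → S` is generically étale if and only if the (finite)
extension of function fields `R(S) ⊂ R(S')` is separable" — in the direction used at 4.16 ("Let
`Y'` be the normalization of `Y` in the field `L` [a finite separable extension of `k(Y)`], then
`ψ : Y' → Y` is a (finite) generically étale alteration of `Y`"), PROVED:

**Theorem** (`exists_etale_localization_away_of_isSeparable`). Let `A` be a ring with fraction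
field `K`, `B` an `A`-algebra of finite presentation which is a domain with fraction field `L`,
compatibly (`A → B → L` = `A → K → L`), and `L/K` separable. Then there is `b ≠ 0` in `B` with
`B[1/b]` étale over `A`.

Proof: `B` is étale over `A` at the prime `(0)` — `B_(0) = L` and `A → K → L` is formally étale
(a localization followed by a separable extension, Mathlib `FormallyEtale.of_isLocalization`,
`FormallyEtale.of_isSeparable`) —, and the étale locus of a finitely presented algebra is open
(Mathlib `Algebra.exists_etale_of_isEtaleAt`). Corollary `…_of_finite` for `B` finite over a
Noetherian `A` (finite presentation is automatic).

## Sources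

* A. J. de Jong, *Smoothness, semi-stability and alterations*, Publ. Math. IHÉS 83 (1996), 2.20
  (p. 61), 4.16 (p. 71).
* A. Grothendieck, EGA IV₄ (1967), 17.6.1, 17.7.8 (étale morphisms, spreading out).
-/

noncomputable section

namespace Literature.AlgebraicGeometry.Resolution

universe u

open Algebra

/-- **Étale at the generic point**: if `A → B → L = Frac B` factors as `A → K = Frac A → L` with
`L/K` separable, then `B` is étale over `A` at the prime `(0)` (`B_(0) = L` is formally étale
over `A`). [folklore] -/
theorem isEtaleAt_bot_of_isSeparable (A B K L : Type u) [CommRing A] [CommRing B] [IsDomain B]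
    [Algebra A B] [Field K] [Field L] [Algebra A K] [IsFractionRing A K] [Algebra B L]
    [IsFractionRing B L] [Algebra K L] [Algebra A L] [IsScalarTower A K L] [IsScalarTower A B L]
    [Algebra.IsSeparable K L] : IsEtaleAt A (⊥ : Ideal B) := by
  -- `A → K → L` is formally étale
  haveI : FormallyEtale A K := FormallyEtale.of_isLocalization (nonZeroDivisors A)
  haveI : FormallyEtale K L := FormallyEtale.of_isSeparable K L
  haveI : FormallyEtale A L := FormallyEtale.comp A K L
  -- `B_(0) ≅ L` over `B`, hence over `A`
  haveI : IsLocalization (⊥ : Ideal B).primeCompl L := by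
    rw [Ideal.primeCompl_bot]
    infer_instance
  let e : L ≃ₐ[B] Localization.AtPrime (⊥ : Ideal B) :=
    IsLocalization.algEquiv (⊥ : Ideal B).primeCompl L (Localization.AtPrime (⊥ : Ideal B))
  exact FormallyEtale.of_equiv (e.restrictScalars A)

/-- **A finitely presented domain over `A` whose fraction field is separable over `Frac A` is
étale over `A` on a non-empty basic open** (de Jong 1996, 2.20: "an alteration `S' → S` is
generically étale if […] the (finite) extension of function fields `R(S) ⊂ R(S')` is
separable"): there is `b ≠ 0` in `B` with `B[1/b]` étale over `A`. [cite: DeJong1996, 2.20, p. 61] -/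
theorem exists_etale_localization_away_of_isSeparable (A B K L : Type u) [CommRing A]
    [CommRing B] [IsDomain B] [Algebra A B] [Algebra.FinitePresentation A B] [Field K] [Field L]
    [Algebra A K] [IsFractionRing A K] [Algebra B L] [IsFractionRing B L] [Algebra K L]
    [Algebra A L] [IsScalarTower A K L] [IsScalarTower A B L] [Algebra.IsSeparable K L] :
    ∃ b : B, b ≠ 0 ∧ Algebra.Etale A (Localization.Away b) := by
  haveI := isEtaleAt_bot_of_isSeparable A B K L
  obtain ⟨b, hb, h⟩ := Algebra.exists_etale_of_isEtaleAt (R := A) (⊥ : Ideal B)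
  exact ⟨b, by simpa using hb, h⟩

/-- The same for `B` finite over a Noetherian `A` (the situation of a normalization in a finite
separable extension of the function field of a variety, de Jong 1996, 4.16): finite
presentation is automatic. [cite: DeJong1996, 4.16, p. 71] -/
theorem exists_etale_localization_away_of_isSeparable_of_finite (A B K L : Type u) [CommRing A]
    [IsNoetherianRing A] [CommRing B] [IsDomain B] [Algebra A B] [Module.Finite A B] [Field K]
    [Field L] [Algebra A K] [IsFractionRing A K] [Algebra B L] [IsFractionRing B L] [Algebra K L]
    [Algebra A L] [IsScalarTower A K L] [IsScalarTower A B L] [Algebra.IsSeparable K L] :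
    ∃ b : B, b ≠ 0 ∧ Algebra.Etale A (Localization.Away b) :=
  haveI : Algebra.FinitePresentation A B :=
    (Algebra.FinitePresentation.of_finiteType (R := A) (A := B)).mp inferInstance
  exists_etale_localization_away_of_isSeparable A B K L

end Literature.AlgebraicGeometry.Resolution

end
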